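import Summits.CriticalPhenomena.PercolationContinuityZ3.Theorems.PercNearOneGluingNoHeavyLowerTailSahiOneStepWindowCertificate
import HarnessLib

/-!
# One-step scheme: the WINDOW STEP — the exact feasibility region of the piece-level pivot certificate — and the reduction of
# `(2′)` for ALL pairs to the WINDOW-PIVOT property

Prover prim-ineq-prove-3 gen 39 (`--supports stmt-CriticalPhenomena-4575`; memo
`run/shared/lean/prim/prim-ineq-prove-3/FINDING-G39-WINDOW.md`).  No definitions, no sorries.

Setting (`…SahiOneStepWindowCertificate`): `e ∉ F`, slot `{N_{insert e F} ≥ t+1}`, `L¹ = {N_F < t}`, `L⁰ = {N_F < t+1}`, `ℓ¹ = μL¹`,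
`ℓ⁰ = μL⁰`, `σ = ℓ⁰ − ℓ¹`, sections `B¹ ⊇ B⁰` of the increasing event `B` at `e`, `b^y = μB^y`, `β¹ = μ(B¹∩L¹)`, `β⁰ = μ(B⁰∩L⁰)`,
`X̃_B = ℓ⁰β¹ − ℓ¹β⁰`, `Ψ_B = ℓ⁰(1−b⁰)(ℓ¹b¹ − β¹) − ℓ¹(1−b¹)(ℓ⁰b⁰ − β⁰)`, `q = 1 − p_e`.
* **`osN_threshold_window_step` (THE WINDOW STEP).**  `(2′)` for `(A,B)` follows from `(2′)` for the three section pairs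
  `(A¹,B¹)@{N_F ≥ t}`, `(A¹,B⁰)@{N_F ≥ t+1}`, `(A⁰,B⁰)@{N_F ≥ t+1}` as soon as `X̃_B ≥ 0` and
  `Ψ_B + q·σ·(b¹−b⁰)·(ℓ⁰ − β⁰) ≥ 0`; the good-pivot step of gen 27 (`osN_threshold_goodPivot_step`) is the case `Ψ_B ≥ 0`.
  Normalised (`c₁ = μ(B¹∣L¹)`, `c₀ = μ(B⁰∣L⁰)`, `Δc = c₁ − c₀`, `1 − ρ = (b¹−b⁰)/(1−b⁰)`, `ε = qσ/(ℓ¹+qσ)`) the two conditions read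
  `0 ≤ Δc` and `(1−ε)·Δc ≤ (1−ρ)(1−c₀)`; on the full cube, with `L = {N_{insert e F} < t+1}`:
  `0 ≤ μ(L)·Cov(1_B, x_e ∣ L) ≤ Cov(1_B, x_e)·μ(L ∣ Bᶜ ∩ {x_e = 0})`.  This pair of inequalities is EXACTLY the feasibility region
  of the gen-38 piece-level certificate LP whenever all piece types are present (memo §2): the LP adds nothing beyond this theorem.
* `osN_threshold_nonneg_of_windowPivots_det`, `sahiE3_threshold_nonneg_of_windowPivots_det` — `(2′)`, hence Kahn C5 / Sahi `C₃` with a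
  threshold first slot, for ALL pairs of increasing events and EVERY product measure, from the WINDOW-PIVOT PROPERTY of `F`-determined
  increasing events (some counted pivot satisfies the two window inequalities).  The window-pivot property absorbs the exact `X̃ ∧ Ψ`
  counterexamples of gen 38 (the codimension-3 and -4 "killers" have window-good apexes) and holds in every test so far (all up-sets on
  ≤ 5 coordinates × density grids, > 5·10⁶ random events on ≤ 10 coordinates, the 4-block CNF families of gen 38; memo §3–4); the rule
  "take the pivot maximising `μ(B∣L,x_e=1) − μ(B∣L,x_e=0)`" has no known failure.
-/

noncomputable section

namespace Summit.CriticalPhenomena.PercolationContinuityZ3.Theorems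

namespace SahiOneStep

open MeasureTheory Finset
open Literature.Probability.Percolation (DeterminedBy determinedBy_iff determinedBy_univ)
open Literature.Probability.LatticeModels (prodBernoulli sahiE3 prodBernoulli_harris)
open Literature.Probability.Percolation.DecisionTree (ind)
open SahiE3Sections (determinedBy_section_insert determinedBy_section_sdiff)
open scoped Classical

variable {ι : Type*} [Fintype ι]

/-! ## The WINDOW step -/

/-- **THE WINDOW STEP.**  `e ∉ F`; `A, B` increasing (arbitrary); slot `{N_{insert e F} ≥ t+1}`; `L¹ = {N_F < t}`, `L⁰ = {N_F < t+1}`,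
`ℓ¹ = μL¹`, `ℓ⁰ = μL⁰`, `σ = ℓ⁰ − ℓ¹`, `B¹ ⊇ B⁰` the sections of `B` at `e`, `b^y = μB^y`, `β¹ = μ(B¹∩L¹)`, `β⁰ = μ(B⁰∩L⁰)`.
If `(2′)` holds for `(A¹,B¹)` at `{N_F ≥ t}` and for `(A¹,B⁰)`, `(A⁰,B⁰)` at `{N_F ≥ t+1}`, the pivot helps `B` inside the ball
(`X̃_B = ℓ⁰β¹ − ℓ¹β⁰ ≥ 0`) and the WINDOW inequality
`ℓ¹(1−b¹)(ℓ⁰b⁰ − β⁰) ≤ ℓ⁰(1−b⁰)(ℓ¹b¹ − β¹) + (1−p_e)(ℓ⁰−ℓ¹)(b¹−b⁰)(ℓ⁰ − β⁰)` (i.e. `Ψ_B ≥ −qσ(b¹−b⁰)μ(L⁰∖B⁰)`) holds,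
then `(2′)` holds for `(A, B)`.  The good-pivot step of gen 27 is the case `Ψ_B ≥ 0`. [this work] -/
theorem osN_threshold_window_step (p : ι → unitInterval) {F : Finset ι} {e : ι} (he : e ∉ F) (t : ℕ)
    {A B : Set (Set ι)} (hA : IsUpperSet A) (hB : IsUpperSet B)
    (h11 : 0 ≤ osN p {ω : Set ι | t ≤ (F.filter (· ∈ ω)).card} (ind {ω : Set ι | insert e ω ∈ A}) (ind {ω : Set ι | insert e ω ∈ B}))
    (h10 : 0 ≤ osN p {ω : Set ι | t + 1 ≤ (F.filter (· ∈ ω)).card} (ind {ω : Set ι | insert e ω ∈ A}) (ind {ω : Set ι | ω \ {e} ∈ B}))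
    (h00 : 0 ≤ osN p {ω : Set ι | t + 1 ≤ (F.filter (· ∈ ω)).card} (ind {ω : Set ι | ω \ {e} ∈ A}) (ind {ω : Set ι | ω \ {e} ∈ B}))
    (hX : (prodBernoulli p).real {ω : Set ι | (F.filter (· ∈ ω)).card < t} *
        (prodBernoulli p).real ({ω : Set ι | ω \ {e} ∈ B} ∩ {ω : Set ι | (F.filter (· ∈ ω)).card < t + 1}) ≤
      (prodBernoulli p).real {ω : Set ι | (F.filter (· ∈ ω)).card < t + 1} *
        (prodBernoulli p).real ({ω : Set ι | insert e ω ∈ B} ∩ {ω : Set ι | (F.filter (· ∈ ω)).card < t}))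
    (hW : (prodBernoulli p).real {ω : Set ι | (F.filter (· ∈ ω)).card < t} * (1 - (prodBernoulli p).real {ω : Set ι | insert e ω ∈ B}) *
        ((prodBernoulli p).real {ω : Set ι | (F.filter (· ∈ ω)).card < t + 1} * (prodBernoulli p).real {ω : Set ι | ω \ {e} ∈ B}
          - (prodBernoulli p).real ({ω : Set ι | ω \ {e} ∈ B} ∩ {ω : Set ι | (F.filter (· ∈ ω)).card < t + 1})) ≤
      (prodBernoulli p).real {ω : Set ι | (F.filter (· ∈ ω)).card < t + 1} * (1 - (prodBernoulli p).real {ω : Set ι | ω \ {e} ∈ B}) *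
        ((prodBernoulli p).real {ω : Set ι | (F.filter (· ∈ ω)).card < t} * (prodBernoulli p).real {ω : Set ι | insert e ω ∈ B}
          - (prodBernoulli p).real ({ω : Set ι | insert e ω ∈ B} ∩ {ω : Set ι | (F.filter (· ∈ ω)).card < t}))
      + (1 - p e) * ((prodBernoulli p).real {ω : Set ι | (F.filter (· ∈ ω)).card < t + 1}
            - (prodBernoulli p).real {ω : Set ι | (F.filter (· ∈ ω)).card < t})
        * ((prodBernoulli p).real {ω : Set ι | insert e ω ∈ B} - (prodBernoulli p).real {ω : Set ι | ω \ {e} ∈ B})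
        * ((prodBernoulli p).real {ω : Set ι | (F.filter (· ∈ ω)).card < t + 1}
            - (prodBernoulli p).real ({ω : Set ι | ω \ {e} ∈ B} ∩ {ω : Set ι | (F.filter (· ∈ ω)).card < t + 1}))) :
    0 ≤ osN p {ω : Set ι | t + 1 ≤ ((insert e F).filter (· ∈ ω)).card} (ind A) (ind B) := by
  set μ := prodBernoulli p with hμ
  set L1 : Set (Set ι) := {ω : Set ι | (F.filter (· ∈ ω)).card < t} with hL1
  set L0 : Set (Set ι) := {ω : Set ι | (F.filter (· ∈ ω)).card < t + 1} with hL0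
  set S : Set (Set ι) := {ω : Set ι | (F.filter (· ∈ ω)).card = t} with hS
  set B1 : Set (Set ι) := {ω : Set ι | insert e ω ∈ B} with hB1
  set B0 : Set (Set ι) := {ω : Set ι | ω \ {e} ∈ B} with hB0
  have hB1u : IsUpperSet B1 := isUpperSet_section_insert hB e
  have hB0u : IsUpperSet B0 := isUpperSet_section_sdiff hB e
  have hB01 : B0 ⊆ B1 := section_sdiff_subset_section_insert hB e
  set l1 : ℝ := μ.real L1 with hl1
  set l0 : ℝ := μ.real L0 with hl0
  set σ : ℝ := μ.real S with hσ
  set b1 : ℝ := μ.real B1 with hb1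
  set b0 : ℝ := μ.real B0 with hb0
  set β1 : ℝ := μ.real (B1 ∩ L1) with hβ1
  set β0 : ℝ := μ.real (B0 ∩ L0) with hβ0
  set q : ℝ := 1 - (p e : ℝ) with hq
  have hq0 : 0 ≤ q := sub_nonneg.2 (p e).2.2
  have hl10 : 0 ≤ l1 := measureReal_nonneg
  have hl00 : 0 ≤ l0 := measureReal_nonneg
  -- `ℓ⁰ = ℓ¹ + σ`
  have cS' : L0 \ L1 = S := by
    ext ω; simp only [hL0, hL1, hS, Set.mem_sdiff, Set.mem_setOf_eq, not_lt]; omega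
  have hl0e : l0 = l1 + σ := by
    have h := measureReal_inter_add_sdiff (μ := μ) (s := L0) (t := L1) MeasurableSet.of_discrete
    have hLL : L0 ∩ L1 = L1 := by
      ext ω; simp only [hL0, hL1, Set.mem_inter_iff, Set.mem_setOf_eq]; constructor
      · exact fun h => h.2
      · exact fun h => ⟨by omega, h⟩
    rw [hLL, cS'] at h; linarith
  have hσ0 : 0 ≤ σ := measureReal_nonneg
  have hl1l0 : l1 ≤ l0 := by linarith
  have hb01 : b0 ≤ b1 := measureReal_mono hB01
  have hb11 : b1 ≤ 1 := by rw [← probReal_univ (μ := μ)]; exact measureReal_mono (Set.subset_univ _)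
  have hb00 : 0 ≤ b0 := measureReal_nonneg
  have hβ0l : β0 ≤ l0 := measureReal_mono Set.inter_subset_right
  have hγ1 : β1 ≤ b1 * l1 := real_inter_ball_le_mul p F hB1u t
  have hγ0 : β0 ≤ b0 * l0 := real_inter_ball_le_mul p F hB0u (t + 1)
  change l1 * β0 ≤ l0 * β1 at hX
  change l1 * (1 - b1) * (l0 * b0 - β0) ≤ l0 * (1 - b0) * (l1 * b1 - β1) + q * (l0 - l1) * (b1 - b0) * (l0 - β0) at hW
  have hσe : l0 - l1 = σ := by linarith
  rw [hσe] at hW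
  have hWσ : l1 * (1 - b1) * (l0 * b0 - β0) ≤ l0 * (1 - b0) * (l1 * b1 - β1) + q * σ * (b1 - b0) * (l0 - β0) := hW
  -- the slack
  have hslack : 0 ≤ q * σ * (b1 - b0) := mul_nonneg (mul_nonneg hq0 hσ0) (by linarith)
  -- the slack hypotheses of the certificate step are stated with `μ S`; we have `σ = μ S` by definition
  by_cases hb0lt : b0 < 1
  · by_cases hl0pos : 0 < l0
    · have hden : 0 < l0 * (1 - b0) := mul_pos hl0pos (by linarith)
      by_cases hcase : q * σ * (b1 - b0) ≤ l1 * (1 - b1)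
      · -- generic case: `r·ℓ⁰(1−b⁰) = ℓ¹(1−b¹) − qσ(b¹−b⁰) ≥ 0`
        set r : ℝ := (l1 * (1 - b1) - q * σ * (b1 - b0)) / (l0 * (1 - b0)) with hr
        have hrden : r * (l0 * (1 - b0)) = l1 * (1 - b1) - q * σ * (b1 - b0) := div_mul_cancel₀ _ (ne_of_gt hden)
        have hr0 : 0 ≤ r := div_nonneg (by linarith) hden.le
        have hb0pos : 0 < 1 - b0 := by linarith
        have hr1 : r * l0 ≤ l1 := by
          have h1 : r * l0 * (1 - b0) = l1 * (1 - b1) - q * σ * (b1 - b0) := by rw [← hrden]; ring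
          have h2 : l1 * (1 - b1) ≤ l1 * (1 - b0) := mul_le_mul_of_nonneg_left (by linarith) hl10
          have h3 : r * l0 * (1 - b0) ≤ l1 * (1 - b0) := by rw [h1]; linarith
          exact le_of_mul_le_mul_right h3 hb0pos
        refine osN_threshold_step_of_pivotCertificate' p he t hA hB r hr0 hr1 h11 h10 h00 hX ?_ ?_ ?_
        · -- e_I + slack ≥ 0  ⟸  window
          change r * (l0 * b0 - β0) ≤ l1 * b1 - β1 + q * σ * (b1 - b0)
          have h1 : r * (l0 * b0 - β0) * (l0 * (1 - b0)) = (l1 * (1 - b1) - q * σ * (b1 - b0)) * (l0 * b0 - β0) := by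
            rw [← hrden]; ring
          -- (l1(1-b1) - qσΔb)(l0 b0 - β0) ≤ (l1 b1 - β1 + qσΔb)·l0(1-b0)  ⟸  window and  (l0 b0 - β0) + l0(1-b0) = l0 - β0
          have h2 : (l1 * (1 - b1) - q * σ * (b1 - b0)) * (l0 * b0 - β0) =
              l1 * (1 - b1) * (l0 * b0 - β0) - q * σ * (b1 - b0) * (l0 * b0 - β0) := by ring
          have h3 : (l1 * b1 - β1 + q * σ * (b1 - b0)) * (l0 * (1 - b0)) =
              l0 * (1 - b0) * (l1 * b1 - β1) + q * σ * (b1 - b0) * (l0 * (1 - b0)) := by ring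
          have hexp : q * σ * (b1 - b0) * (l0 - β0) = q * σ * (b1 - b0) * (l0 * b0 - β0) + q * σ * (b1 - b0) * (l0 * (1 - b0)) := by
            ring
          have key : r * (l0 * b0 - β0) * (l0 * (1 - b0)) ≤ (l1 * b1 - β1 + q * σ * (b1 - b0)) * (l0 * (1 - b0)) := by
            rw [h1, h2, h3]; linarith
          exact le_of_mul_le_mul_right key hden
        · -- e_II + slack ≥ 0 :  r ℓ⁰ b⁰ ≤ ℓ¹ b⁰ ≤ ℓ¹ b¹
          change r * (l0 * b0) ≤ l1 * b1 + q * σ * (b1 - b0)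
          have h1 : r * l0 * b0 ≤ l1 * b0 := mul_le_mul_of_nonneg_right hr1 hb00
          have h2 : l1 * b0 ≤ l1 * b1 := mul_le_mul_of_nonneg_left hb01 hl10
          have h3 : r * (l0 * b0) = r * l0 * b0 := by ring
          rw [h3]; linarith
        · -- e_III + slack = 0
          change l1 * (1 - b1) ≤ r * (l0 * (1 - b0)) + q * σ * (b1 - b0)
          rw [hrden]; linarith
      · -- large slack: `r = 0` works
        rw [not_le] at hcase
        refine osN_threshold_step_of_pivotCertificate' p he t hA hB 0 le_rfl ?_ h11 h10 h00 hX ?_ ?_ ?_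
        · change 0 * l0 ≤ l1; rw [zero_mul]; exact hl10
        · change 0 * (l0 * b0 - β0) ≤ l1 * b1 - β1 + q * σ * (b1 - b0); rw [zero_mul]; linarith
        · change 0 * (l0 * b0) ≤ l1 * b1 + q * σ * (b1 - b0); rw [zero_mul]
          linarith [mul_nonneg hl10 (hb00.trans hb01)]
        · change l1 * (1 - b1) ≤ 0 * (l0 * (1 - b0)) + q * σ * (b1 - b0); linarith
    · -- `ℓ⁰ = 0`: then `ℓ¹ = 0` and `r = 0` works
      have hl0z : l0 = 0 := le_antisymm (not_lt.1 hl0pos) hl00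
      have hl1z : l1 = 0 := le_antisymm (hl0z ▸ hl1l0) hl10
      refine osN_threshold_step_of_pivotCertificate' p he t hA hB 0 le_rfl ?_ h11 h10 h00 hX ?_ ?_ ?_
      · change 0 * l0 ≤ l1; rw [zero_mul]; exact hl10
      · change 0 * (l0 * b0 - β0) ≤ l1 * b1 - β1 + q * σ * (b1 - b0); rw [zero_mul]; linarith
      · change 0 * (l0 * b0) ≤ l1 * b1 + q * σ * (b1 - b0); rw [zero_mul]
        linarith [mul_nonneg hl10 (hb00.trans hb01)]
      · change l1 * (1 - b1) ≤ 0 * (l0 * (1 - b0)) + q * σ * (b1 - b0); rw [hl1z]; linarith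
  · -- `b⁰ = 1`: then `b¹ = 1` and `r = 0` works
    have hb0e : b0 = 1 := le_antisymm (hb01.trans hb11) (not_lt.1 hb0lt)
    have hb1e : b1 = 1 := le_antisymm hb11 (hb0e ▸ hb01)
    refine osN_threshold_step_of_pivotCertificate' p he t hA hB 0 le_rfl ?_ h11 h10 h00 hX ?_ ?_ ?_
    · change 0 * l0 ≤ l1; rw [zero_mul]; exact hl10
    · change 0 * (l0 * b0 - β0) ≤ l1 * b1 - β1 + q * σ * (b1 - b0); rw [zero_mul]; linarith
    · change 0 * (l0 * b0) ≤ l1 * b1 + q * σ * (b1 - b0); rw [zero_mul]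
      linarith [mul_nonneg hl10 (hb00.trans hb01)]
    · change l1 * (1 - b1) ≤ 0 * (l0 * (1 - b0)) + q * σ * (b1 - b0); rw [hb1e, hb0e]; simp

/-! ## `(2′)` for all pairs from the WINDOW-PIVOT property of `F`-determined events -/

/-- **REDUCTION OF `(2′)` (ALL PRODUCT MEASURES, ALL PAIRS) TO THE WINDOW-PIVOT PROPERTY OF `F`-DETERMINED EVENTS.**  Suppose that
for every nonempty block `F`, every level `t` and every increasing `B` DETERMINED BY `F` there is a counted pivot `e ∈ F` inside the
WINDOW for `B` at `(F ∖ e, t)`: `X̃_B(e) ≥ 0` and `Ψ_B(e) + (1−p_e)(ℓ⁰−ℓ¹)(b¹−b⁰)(ℓ⁰−β⁰) ≥ 0` (notation of `osN_threshold_window_step`).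
Then `n_{N_F ≥ t}(A,B) ≥ 0` for EVERY block `F`, level `t` and ALL increasing `A, B` (free coordinates are peeled by
`osMp_osN_nonneg_of_determined`). [this work] -/
theorem osN_threshold_nonneg_of_windowPivots_det (p : ι → unitInterval)
    (hwin : ∀ (F : Finset ι) (t : ℕ) (B : Set (Set ι)), F.Nonempty → IsUpperSet B → DeterminedBy B (↑F : Set ι) → ∃ e ∈ F,
      (prodBernoulli p).real {ω : Set ι | ((F.erase e).filter (· ∈ ω)).card < t} *
          (prodBernoulli p).real ({ω : Set ι | ω \ {e} ∈ B} ∩ {ω : Set ι | ((F.erase e).filter (· ∈ ω)).card < t + 1}) ≤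
        (prodBernoulli p).real {ω : Set ι | ((F.erase e).filter (· ∈ ω)).card < t + 1} *
          (prodBernoulli p).real ({ω : Set ι | insert e ω ∈ B} ∩ {ω : Set ι | ((F.erase e).filter (· ∈ ω)).card < t}) ∧
      (prodBernoulli p).real {ω : Set ι | ((F.erase e).filter (· ∈ ω)).card < t} *
          (1 - (prodBernoulli p).real {ω : Set ι | insert e ω ∈ B}) *
          ((prodBernoulli p).real {ω : Set ι | ((F.erase e).filter (· ∈ ω)).card < t + 1} *
              (prodBernoulli p).real {ω : Set ι | ω \ {e} ∈ B}
            - (prodBernoulli p).real ({ω : Set ι | ω \ {e} ∈ B} ∩ {ω : Set ι | ((F.erase e).filter (· ∈ ω)).card < t + 1})) ≤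
        (prodBernoulli p).real {ω : Set ι | ((F.erase e).filter (· ∈ ω)).card < t + 1} *
          (1 - (prodBernoulli p).real {ω : Set ι | ω \ {e} ∈ B}) *
          ((prodBernoulli p).real {ω : Set ι | ((F.erase e).filter (· ∈ ω)).card < t} *
              (prodBernoulli p).real {ω : Set ι | insert e ω ∈ B}
            - (prodBernoulli p).real ({ω : Set ι | insert e ω ∈ B} ∩ {ω : Set ι | ((F.erase e).filter (· ∈ ω)).card < t}))
        + (1 - p e) * ((prodBernoulli p).real {ω : Set ι | ((F.erase e).filter (· ∈ ω)).card < t + 1}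
              - (prodBernoulli p).real {ω : Set ι | ((F.erase e).filter (· ∈ ω)).card < t})
          * ((prodBernoulli p).real {ω : Set ι | insert e ω ∈ B} - (prodBernoulli p).real {ω : Set ι | ω \ {e} ∈ B})
          * ((prodBernoulli p).real {ω : Set ι | ((F.erase e).filter (· ∈ ω)).card < t + 1}
              - (prodBernoulli p).real ({ω : Set ι | ω \ {e} ∈ B} ∩ {ω : Set ι | ((F.erase e).filter (· ∈ ω)).card < t + 1})))
    (F : Finset ι) (t : ℕ) {A B : Set (Set ι)} (hA : IsUpperSet A) (hB : IsUpperSet B) :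
    0 ≤ osN p {ω : Set ι | t ≤ (F.filter (· ∈ ω)).card} (ind A) (ind B) := by
  -- Step 1: `B` determined by `F` (and `A` arbitrary), by strong induction on `#F`.
  have key : ∀ (n : ℕ) (F : Finset ι), F.card = n → ∀ (t : ℕ) (A B : Set (Set ι)), IsUpperSet A → IsUpperSet B →
      DeterminedBy B (↑F : Set ι) → 0 ≤ osN p {ω : Set ι | t ≤ (F.filter (· ∈ ω)).card} (ind A) (ind B) := by
    intro n
    induction n using Nat.strong_induction_on with
    | _ n ih =>
    intro F hn t A B hA hB hBF
    cases t with
    | zero => rw [threshold_zero, osN_ind_ind_univ]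
    | succ t =>
      rcases F.eq_empty_or_nonempty with hF | hF
      · subst hF; rw [threshold_empty_succ, osN_ind_ind_empty]
      · obtain ⟨e, heF, hX, hW⟩ := hwin F t B hF hB hBF
        have hF' : F = insert e (F.erase e) := (Finset.insert_erase heF).symm
        have hcard : (F.erase e).card < n := by rw [← hn]; exact Finset.card_erase_lt_of_mem heF
        have hcoe : (↑F : Set ι) \ {e} = ↑(F.erase e) := by rw [Finset.coe_erase]
        have hB1 : DeterminedBy {ω : Set ι | insert e ω ∈ B} (↑(F.erase e) : Set ι) := hcoe ▸ determinedBy_section_insert hBF e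
        have hB0 : DeterminedBy {ω : Set ι | ω \ {e} ∈ B} (↑(F.erase e) : Set ι) := hcoe ▸ determinedBy_section_sdiff hBF e
        rw [hF']
        refine osN_threshold_window_step p (F.notMem_erase e) t hA hB ?_ ?_ ?_ hX hW
        · exact ih _ hcard (F.erase e) rfl t _ _ (isUpperSet_section_insert hA e) (isUpperSet_section_insert hB e) hB1
        · exact ih _ hcard (F.erase e) rfl (t + 1) _ _ (isUpperSet_section_insert hA e) (isUpperSet_section_sdiff hB e) hB0
        · exact ih _ hcard (F.erase e) rfl (t + 1) _ _ (isUpperSet_section_sdiff hA e) (isUpperSet_section_sdiff hB e) hB0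
  -- Step 2: peel the coordinates outside `F` (free-coordinate extension).
  exact (osMp_osN_nonneg_of_determined p (determinedBy_threshold F t)
    (fun A' B' hA' hB' _ _ => osMp_threshold_nonneg_all p F t hA' hB')
    (fun A' B' hA' hB' _ hB'F => key _ F rfl t A' B' hA' hB' hB'F) hA hB).2

/-- **KAHN C5 / SAHI `C₃` FOR A THRESHOLD FIRST SLOT, ALL PAIRS, FROM THE WINDOW-PIVOT PROPERTY OF `F`-DETERMINED EVENTS.**  Under the
hypothesis of `osN_threshold_nonneg_of_windowPivots_det`: `0 ≤ E₃(1_{N_F ≥ t}, 1_A, 1_B)` for every product measure, every block `F`,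
level `t` and ALL increasing `A, B`. [this work] -/
theorem sahiE3_threshold_nonneg_of_windowPivots_det (p : ι → unitInterval)
    (hwin : ∀ (F : Finset ι) (t : ℕ) (B : Set (Set ι)), F.Nonempty → IsUpperSet B → DeterminedBy B (↑F : Set ι) → ∃ e ∈ F,
      (prodBernoulli p).real {ω : Set ι | ((F.erase e).filter (· ∈ ω)).card < t} *
          (prodBernoulli p).real ({ω : Set ι | ω \ {e} ∈ B} ∩ {ω : Set ι | ((F.erase e).filter (· ∈ ω)).card < t + 1}) ≤
        (prodBernoulli p).real {ω : Set ι | ((F.erase e).filter (· ∈ ω)).card < t + 1} *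
          (prodBernoulli p).real ({ω : Set ι | insert e ω ∈ B} ∩ {ω : Set ι | ((F.erase e).filter (· ∈ ω)).card < t}) ∧
      (prodBernoulli p).real {ω : Set ι | ((F.erase e).filter (· ∈ ω)).card < t} *
          (1 - (prodBernoulli p).real {ω : Set ι | insert e ω ∈ B}) *
          ((prodBernoulli p).real {ω : Set ι | ((F.erase e).filter (· ∈ ω)).card < t + 1} *
              (prodBernoulli p).real {ω : Set ι | ω \ {e} ∈ B}
            - (prodBernoulli p).real ({ω : Set ι | ω \ {e} ∈ B} ∩ {ω : Set ι | ((F.erase e).filter (· ∈ ω)).card < t + 1})) ≤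
        (prodBernoulli p).real {ω : Set ι | ((F.erase e).filter (· ∈ ω)).card < t + 1} *
          (1 - (prodBernoulli p).real {ω : Set ι | ω \ {e} ∈ B}) *
          ((prodBernoulli p).real {ω : Set ι | ((F.erase e).filter (· ∈ ω)).card < t} *
              (prodBernoulli p).real {ω : Set ι | insert e ω ∈ B}
            - (prodBernoulli p).real ({ω : Set ι | insert e ω ∈ B} ∩ {ω : Set ι | ((F.erase e).filter (· ∈ ω)).card < t}))
        + (1 - p e) * ((prodBernoulli p).real {ω : Set ι | ((F.erase e).filter (· ∈ ω)).card < t + 1}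
              - (prodBernoulli p).real {ω : Set ι | ((F.erase e).filter (· ∈ ω)).card < t})
          * ((prodBernoulli p).real {ω : Set ι | insert e ω ∈ B} - (prodBernoulli p).real {ω : Set ι | ω \ {e} ∈ B})
          * ((prodBernoulli p).real {ω : Set ι | ((F.erase e).filter (· ∈ ω)).card < t + 1}
              - (prodBernoulli p).real ({ω : Set ι | ω \ {e} ∈ B} ∩ {ω : Set ι | ((F.erase e).filter (· ∈ ω)).card < t + 1})))
    (F : Finset ι) (t : ℕ) {A B : Set (Set ι)} (hA : IsUpperSet A) (hB : IsUpperSet B) :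
    0 ≤ sahiE3 (prodBernoulli p) {ω : Set ι | t ≤ (F.filter (· ∈ ω)).card} A B := by
  rw [← osT_ind_ind, osT_eq_osMp_add_osN]
  exact add_nonneg (osMp_threshold_nonneg_all p F t hA hB) (osN_threshold_nonneg_of_windowPivots_det p hwin F t hA hB)

end SahiOneStep

end Summit.CriticalPhenomena.PercolationContinuityZ3.Theorems
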